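import Summits.BirchSwinnertonDyer.Rank1Residual.X2.SplitHalvesAssembly
import Summits.BirchSwinnertonDyer.Rank1Residual.X2.NonsplitCellCClass
import HarnessLib

/-!
# O9 ∩ {SPLIT} AT THE CLASS LEVEL: `X2c ∩ {split} ⇒ BSD(E,p)` from the four declared residuals
# c1s / c2s / c3s / CTL-split + Mazur's main conjecture on X2b ∩ {split} + PUBLISHED facts — every
# datum of the road PRODUCED; the planner's `stub_split` of line b1 (cell `bsd-eis`, seat
# `bsd-eis-cgshw` g6; route `EisensteinPrimes`, crux 4 `BSDpOnCellC`; memo `cgshw-MEMO-7.md` §8(2))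

HONEST FRAMING (cell `bsd-eis`): theorems only; nothing booked; X2 stays CONSTRUCTION-SHAPED; no label
moves. This is the SPLIT twin of `X2/NonsplitCellCClass.lean` (p407684): the road of
`X2/SplitHalvesAssembly.lean` concludes `BSDp W p` at a rank-one X2 pair at a SPLIT `p` AT A HEEGNER
DATUM, from Hsieh 2014 Thm. 1 (PUB), the residuals c1s `SplitHsiehFrameResidualAt`, c2s
`SplitBDPValueOnTree`, c3s `SplitIMCEqOnTree`, the control atom `SplitControlOnTree` (all
`X2/SplitHalvesOnTree.lean` / `X2/SplitHalvesAssembly.lean`) and the partner's rank-zero `p`-part. This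
file PRODUCES every datum from PUBLISHED named facts and tree theorems, exactly as p407684 does, so that
the road reads as the registered stub of line b1:

  `stub_split : ∀ W p, X2.CellC W p → split(p) → BSDp W p`  ⇐  c1s ∧ c2s ∧ c3s ∧ CTL-split (at every
  split CellC pair) + `X2.MazurMainConjectureAt` on X2b ∩ {split} (crux 3's SPLIT half = row A10-split,
  needed only when the CGLS twist lacks the Greenberg–Vatsal parity) + PUBLISHED facts.

Differences from the non-split twin, all forced by MEMO-7 §1: (i) the control theorem is an INPUT
(`hCTL`; at a non-split `p` it is p398508's theorem, which is why p407684 carries the five cited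
cohomological facts `hPT … hBr` and this file does not); (ii) the CGLS twist is SPLIT at `p` (the tree
lemma `hasSplitMultiplicativeReductionAtPrime_iff_of_smul_eq_quadraticTwist` is an `iff`), so the
partner input is Mazur's MC on CellB ∩ {split}; (iii) split type passes along isogenies
(`IsogenyQuotientLine.hasSplitMultiplicativeReductionAtPrime_of_isIsogenous`) for the move to the
optimal curve. Everything else — `w(E) = −1`, the admissible `K` (Hoffstein–Luo), the Heegner datum and
its `K`-point (Gross 1984 / Darmon 2004), non-torsion by Gross–Zagier, the twist transport package,
`htamK` at every odd `p` (p407546), the anticyclotomic `ℤ_p`-extension and generator, the degree-one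
prime, Edixhoven / Mazur 1978 / Cassels for the Manin move — is the sign-free text of p407684.

* `bsdp_of_cellC_of_split_of_manin_of_residuals` — pointwise, at a split CellC pair carrying a Manin
  datum prime to `p`.
* `bsdp_of_cellC_of_split_of_residuals` — **the class-level statement** (`stub_split` from named
  residuals): NO per-pair binder.

So ALL of O9 (crux 4 `BSDpOnCellC`) now reads class-wide, with no per-pair binder, as PUBLISHED facts +
{c1, c2, c3-div, c3-μλ}·{non-split, split} + CTL-split + Mazur's MC on CellB (crux 3, both signs) —
p407684 (non-split) and this file (split). CONDITIONAL on every listed binder (the residuals are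
`@[conjecture]` predicates NOT in print at a reducible `p ‖ N`; Keller–Yin is a PREPRINT; Hsieh 2014
Thm. 1 is PUB). Nothing booked; no label change.

References: [CastellaEtAl2021] Thm. 5.3.1 and (5.6); [Hsieh2014] Thm. 1; [Castella2018] Thm. 2.3, 3.2,
§5; [Castella2018Exceptional] Thm. 2.11; [KellerYin2024] §5.1, App. B (PRE); [Mazur1978] Cor. 4.1;
[MilneADT2006] Thm. I.7.3 (Cassels); [GrossZagier1986] I.(6.3), V.§2; [Gross1991] (1.1); [Darmon2004]
Thm. 3.6; [Miller2011LMS] Def. 1.1.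
-/

set_option autoImplicit false

noncomputable section

open scoped Classical MatrixGroups ModularForm

open CongruenceSubgroup WeierstrassCurve NumberField IsDedekindDomain Field PowerSeries
  Literature.NumberTheory.EllipticCurves Literature.NumberTheory.EllipticCurves.GreenbergSelmer
  Literature.NumberTheory.EllipticCurves.ModularForms Literature.NumberTheory.QuadraticFields
  Literature.NumberTheory.EllipticCurves.Rank1Residual
  Literature.NumberTheory.EllipticCurves.Rank1Residual.Typed
  Literature.NumberTheory.EllipticCurves.KrizLi2019
  Literature.NumberTheory.EllipticCurves.GreenbergVatsal2000
  Literature.NumberTheory.EllipticCurves.Wuthrich2014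
  Literature.NumberTheory.EllipticCurves.SteinWuthrich2013
  Literature.NumberTheory.GaloisRepresentations Literature.NumberTheory.GaloisCohomology
  Literature.NumberTheory.Automorphic
  Summit.BirchSwinnertonDyer.Rank1Residual.X11b.AcSelmer
  Summit.BirchSwinnertonDyer.Rank1Residual.X11b.Halves
  Summit.BirchSwinnertonDyer.Rank1Residual.X11b

namespace Summit.BirchSwinnertonDyer.Rank1Residual.X2

/-! ### Pointwise: a split CellC pair carrying a Manin datum prime to `p` -/

section Pointwise

variable (W : WeierstrassCurve ℚ) [W.IsElliptic] [W.IsGloballyMinimal] (p : ℕ) [Fact p.Prime]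

/-- **X2c ∩ {SPLIT} ⇒ `BSD(E,p)` at a pair carrying a Manin datum prime to `p`, from the four declared
residuals at the pair (c1s, c2s, c3s, CTL-split), Mazur's MC on X2b ∩ {split}, and PUBLISHED facts —
every datum of the road PRODUCED** (split twin of p407684's
`bsdp_of_cellC_of_not_split_of_manin_of_residuals`, same construction of the data). For a rank-one X2
pair `(E,p)` at a SPLIT `p` with `HasPrimeToManinDatum W p`: `w(E) = −1` (modularity); an admissible
`K` (`d_K` odd `< −4`, Heegner hypothesis for `N_E` — so `p ∣ N_E` splits —, `L(E^{d_K},1) ≠ 0`: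
Hoffstein–Luo via `exists_admissibleField_of_rootNumber_eq_neg_one`); a Heegner datum and its
`K`-rational point `P` (`hHP`), of infinite order by Gross–Zagier (`L'(E/K,1) = L'(E,1)·L(E^K,1) ≠ 0`);
a globally minimal model `Wd` of the twist with its two Tamagawa values (`twistTransportPackage_holds`)
and `ord_p ∏_w c_w(E/K) = 2·ord_p ∏c(E)` (`padicValNat_tamagawaProduct_baseChange_of_heegner_odd`); the
partner is a rank-zero X2 pair SPLIT at `p` (`hasSplitMultiplicativeReductionAtPrime_iff_of_smul_eq_quadraticTwist`)
whose `p`-part comes from X2a (`targetA_of_published`) when it has the GV parity and from the input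
`hMCB` (Mazur's MC on CellB ∩ {split}) otherwise; the anticyclotomic `ℤ_p`-extension, a topological
generator, a degree-one prime; then `bsdp_of_cellC_of_split_of_hsieh2014_of_halvesOnTree_of_partner`.
Binders: PUBLISHED named facts (incl. Hsieh 2014 Thm. 1 `hH`), the four residuals c1s `hres`, c2s `h2`,
c3s `h3`, CTL-split `hCTL` AT THE PAIR (NOT in print at a reducible split `p ‖ N`; c3s = Keller–Yin
§5.1 shape, PREPRINT), and `hMCB`. NO cited cohomological fact is needed (the control theorem is an
input here). CONDITIONAL on every listed binder; nothing booked; no label change.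
[cite: CastellaEtAl2021, Thm. 5.3.1 and (5.5)–(5.7)] [cite: Hsieh2014, Thm. 1 (arXiv:1112.1580 pp. 3–4)]
[claim: KellerYin2024, status: under-review] [cite: Darmon2004, Thm. 3.6–3.7]
[cite: GreenbergLNM1716, §1] [cite: Gross1991, (1.1)] [cite: Miller2011LMS, Def. 1.1] -/
theorem bsdp_of_cellC_of_split_of_manin_of_residuals
    (hGV : lambdaMu_multiplicative_of_gvPar) (hWu : thm16_charIdeal_dvd_multiplicative_of_reducible)
    (hJs : thm61_splitMultiplicative) (hJn : thm61_nonsplitMultiplicative)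
    (hHs : exists_isSplitMultCanonical) (hHn : exists_isMultCanonical)
    (hpar : nonempty_modularParametrizationData)
    (hGS : ∀ (W : WeierstrassCurve ℚ) [W.IsElliptic] [W.IsGloballyMinimal] (p : ℕ) [Fact p.Prime],
      greenberg_stevens (W := W) (p := p))
    (hnf : exists_isNewformOf) (hH : hsieh2014_exists_anticyclotomicPAdicLFunction)
    (hGZ : ∀ (N : ℕ) [NeZero N] (W : WeierstrassCurve ℚ) (K : Type) [Field K] [NumberField K],
      gross_zagier N W K)
    (hKo : ∀ (N : ℕ) [NeZero N] (W : WeierstrassCurve ℚ) (K : Type) [Field K] [NumberField K],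
      kolyvagin N W K)
    (hHP : ∀ (N : ℕ) [NeZero N] (W : WeierstrassCurve ℚ) (K : Type) [Field K] [NumberField K],
      heegnerPointComplex_mem_range_map N W K)
    (hGZK : rank_eq_analyticRank_of_analyticRank_le_one)
    (hHL : HoffsteinLuo1997_exists_twist_L_one_ne_zero)
    (hc : CellC W p) (hs : W.HasSplitMultiplicativeReductionAtPrime p)
    (hMan : HasPrimeToManinDatum W p)
    (hres : SplitHsiehFrameResidualAt W p) (h2 : SplitBDPValueOnTree W p)
    (h3 : SplitIMCEqOnTree W p) (hCTL : SplitControlOnTree W p)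
    (hMCB : ∀ (W' : WeierstrassCurve ℚ) [W'.IsElliptic] [W'.IsGloballyMinimal],
      CellB W' p → W'.HasSplitMultiplicativeReductionAtPrime p → MazurMainConjectureAt W' p) :
    BSDp W p := by
  have hp : p.Prime := Fact.out
  have hmod : hasEntireLFunction_rat := WeierstrassCurve.hasEntireLFunction_rat_of_exists_isNewformOf hnf
  obtain ⟨hr, hp2, hred, hmult⟩ := hc
  haveI : NeZero (W.conductorNorm ℤ) := ⟨(W.conductorNorm_pos_holds).ne'⟩
  -- `w(E) = -1`
  have hw : W.rootNumber = -1 := by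
    rw [WeierstrassCurve.rootNumber_eq_neg_one_pow_analyticRank_of_exists_isNewformOf hnf W, hr]
    norm_num
  -- the admissible auxiliary field
  obtain ⟨K, _, _, hK, hodd, hlt, hHN, hHp, hLK⟩ :=
    exists_admissibleField_of_rootNumber_eq_neg_one hnf hHL W hw p
  -- the datum with `p ∤ c`, a Heegner datum and the `K`-rational Heegner point
  obtain ⟨Dt, hcM⟩ := hMan
  obtain ⟨β, hβ⟩ := exists_dvd_sq_sub_discr_holds (W.conductorNorm ℤ) K hK hHN
  obtain ⟨H, -⟩ := nonempty_heegnerDatum_holds (W.conductorNorm ℤ) K hK hβ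
  obtain ⟨ι⟩ : Nonempty (K →+* ℂ) := inferInstance
  obtain ⟨P, hP⟩ := hHP (W.conductorNorm ℤ) W K hK hHN Dt H ι
  -- the Heegner point has infinite order: `L'(E/K,1) = L'(E,1)·L(E^K,1) ≠ 0` (Gross–Zagier)
  have hL0 : W.entireLFunction 1 = 0 := entireLFunction_one_eq_zero_of_analyticRank_eq_one hr
  obtain ⟨-, hderiv⟩ := leadingLCoeff_eq_deriv_of_analyticRank_eq_one hr
  have hLKd : LDerivEK W K ≠ 0 := by
    rw [lDerivEK_eq_deriv_mul W K hmod hL0]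
    exact mul_ne_zero hderiv hLK
  have hPH : IsHeegnerPoint (W.conductorNorm ℤ) W K P := ⟨Dt, H, ι, hP⟩
  have hPinf : ¬ IsOfFinAddOrder P :=
    (lDerivEK_ne_zero_iff_not_isOfFinAddOrder W (W.conductorNorm ℤ) K (hGZ _ W K) hK hHN hPH).mp hLKd
  -- a globally minimal model of the twist (Néron) and its transport values
  have hD0 : (NumberField.discr K : ℚ) ≠ 0 := by exact_mod_cast NumberField.discr_ne_zero K
  haveI hEt : (W.quadraticTwist (NumberField.discr K : ℚ)).IsElliptic :=
    W.isElliptic_quadraticTwist hD0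
  obtain ⟨Cd, hCd⟩ := hasGlobalMinimalModel_rat_holds (W.quadraticTwist (NumberField.discr K : ℚ))
  set Wd : WeierstrassCurve ℚ := Cd • W.quadraticTwist (NumberField.discr K : ℚ) with hWd_def
  haveI : Wd.IsGloballyMinimal := hCd
  have hWd : Cd • W.quadraticTwist (NumberField.discr K : ℚ) = Wd := rfl
  have hC : Cd⁻¹ • Wd = W.quadraticTwist (NumberField.discr K : ℚ) := by
    rw [← hWd, inv_smul_smul]
  obtain ⟨htam, hu⟩ := twistTransportPackage_holds W p K Wd Cd ⟨hr, hp2, hred, hmult⟩ hK hodd hHN hWd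
  have htamK : padicValNat p (W.baseChange K).tamagawaProduct = 2 * padicValNat p W.tamagawaProduct :=
    padicValNat_tamagawaProduct_baseChange_of_heegner_odd W p hp2 K hK hodd hHN hHp
  -- the twist: analytic rank `0`, X2, SPLIT at `p`; its rank-zero `p`-part by parity cases
  have hLd : Wd.entireLFunction 1 ≠ 0 := by
    rw [← hWd, entireLFunction_smul]; exact hLK
  have hrd : Wd.analyticRank = 0 := (Wd.analyticRank_eq_zero_iff_holds (hmod _)).2 hLd
  have hXd : ClassX2 Wd p := classX2_twist W p ⟨hp2, hred, hmult⟩ K hK hHp Wd ⟨Cd⁻¹, hC⟩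
  have hsd : Wd.HasSplitMultiplicativeReductionAtPrime p :=
    (hasSplitMultiplicativeReductionAtPrime_iff_of_smul_eq_quadraticTwist W Wd hK p hp2 hmult hHp
      hC).mpr hs
  have hbsdd : BSDp Wd p := by
    by_cases hgv : GVPar Wd p
    · exact targetA_of_published hGV hWu hJs hJn hHs hHn hGZK hmod hpar hGS Wd p ⟨hrd, hXd, hgv⟩
    · exact bsdp_of_mazurMainConjectureAt_of_analyticRank_eq_zero hJs hJn hHs hHn hGZK hmod hpar Wd p
        (hGS Wd p) hXd.1 hXd.2.2 hrd (hMCB Wd ⟨hrd, hXd, hgv⟩ hsd)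
  have htw : PPartRankZero Wd p :=
    pPartRankZero_of_pPart hGZK Wd p hrd (pPart_of_bsdp hmod hGZK Wd p (by omega) hbsdd)
  -- the anticyclotomic `ℤ_p`-extension, a topological generator, a degree-one prime above `p`
  haveI : IsTotallyComplex K := hK.2
  obtain ⟨κ, hκ⟩ := ZpExtension.exists_isAnticyclotomic_holds (K := K) (p := p) hK.1
    (fun w ↦ IsTotallyComplex.isComplex w)
  obtain ⟨γ, hγ⟩ := κ.surjective (Multiplicative.ofAdd 1)
  haveI : Fact (κ.IsTopGenerator γ) := ⟨hγ⟩
  obtain ⟨𝔭, h𝔭, he, hf⟩ := X11b.exists_degreeOnePrime_of_splitsIn K p hK.1 (hHp p hp dvd_rfl)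
  -- conclude by the split road
  exact bsdp_of_cellC_of_split_of_hsieh2014_of_halvesOnTree_of_partner W p hnf hH (W.conductorNorm ℤ) K
    Dt H ι P (hGZ _ W K) (hKo _ W K) hGZK ⟨hr, hp2, hred, hmult⟩ hs rfl hK hlt hHN hHp hP hPinf hcM hLK
    Wd Cd hWd htw htam hu htamK κ hκ γ 𝔭 h𝔭 he hf hres h2 h3 hCTL

end Pointwise

/-! ### Class level: the Manin condition moved to the optimal curve -/

section ClassLevel

/-- **X2c ∩ {SPLIT} ⇒ `BSD(E,p)`, CLASS LEVEL — the `stub_split` of line b1 from c1s ∧ c2s ∧ c3s ∧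
CTL-split + Mazur's MC on X2b ∩ {split} + PUBLISHED facts, NO per-pair binder** (split twin of
p407684's `bsdp_of_cellC_of_not_split_of_residuals`). For every rank-one X2 pair `(E,p)` at a SPLIT `p`:
`BSD(E,p)`, given the PUBLISHED named facts (incl. Edixhoven's integrality `hEd`, Mazur 1978 Cor. 4.1
`hMaz`, Cassels `hCassels`), the four declared residuals at every split CellC pair (`hres` c1s
`SplitHsiehFrameResidualAt`, `h2` c2s `SplitBDPValueOnTree`, `h3` c3s `SplitIMCEqOnTree`, `hCTL`
CTL-split `SplitControlOnTree` — NOT in print), and Mazur's main conjecture at every X2b ∩ {split} pair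
(`hMCB` — crux 3's split half; used only at the CGLS partner when it lacks the GV parity). Proof: the
`X₀(N)`-optimal curve `W₀ ∼ W` carries a Manin datum prime to `p`
(`exists_isIsogenous_hasPrimeToManinDatum`); CellC and split type pass to `W₀` (`CellC.of_isIsogenous`,
`IsogenyQuotientLine.hasSplitMultiplicativeReductionAtPrime_of_isIsogenous`);
`bsdp_of_cellC_of_split_of_manin_of_residuals` at `W₀`; Cassels (`bsdp_of_isIsogenous_of_bsdp`).
CONDITIONAL on every listed binder; nothing booked; X2 CONSTRUCTION-SHAPED; no label change.
[cite: CastellaEtAl2021, Thm. 5.3.1] [cite: Mazur1978, Cor. 4.1] [cite: MilneADT2006, Thm. I.7.3]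
[cite: Hsieh2014, Thm. 1 (arXiv:1112.1580 pp. 3–4)] [claim: KellerYin2024, status: under-review]
[cite: Miller2011LMS, Def. 1.1] -/
theorem bsdp_of_cellC_of_split_of_residuals
    (hGV : lambdaMu_multiplicative_of_gvPar) (hWu : thm16_charIdeal_dvd_multiplicative_of_reducible)
    (hJs : thm61_splitMultiplicative) (hJn : thm61_nonsplitMultiplicative)
    (hHs : exists_isSplitMultCanonical) (hHn : exists_isMultCanonical)
    (hpar : nonempty_modularParametrizationData)
    (hGS : ∀ (W : WeierstrassCurve ℚ) [W.IsElliptic] [W.IsGloballyMinimal] (p : ℕ) [Fact p.Prime],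
      greenberg_stevens (W := W) (p := p))
    (hnf : exists_isNewformOf) (hH : hsieh2014_exists_anticyclotomicPAdicLFunction)
    (hGZ : ∀ (N : ℕ) [NeZero N] (W : WeierstrassCurve ℚ) (K : Type) [Field K] [NumberField K],
      gross_zagier N W K)
    (hKo : ∀ (N : ℕ) [NeZero N] (W : WeierstrassCurve ℚ) (K : Type) [Field K] [NumberField K],
      kolyvagin N W K)
    (hHP : ∀ (N : ℕ) [NeZero N] (W : WeierstrassCurve ℚ) (K : Type) [Field K] [NumberField K],
      heegnerPointComplex_mem_range_map N W K)
    (hGZK : rank_eq_analyticRank_of_analyticRank_le_one)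
    (hHL : HoffsteinLuo1997_exists_twist_L_one_ne_zero)
    (hEd : edixhoven_optimalManinConstant_integral) (hMaz : mazur_not_dvd_maninConstant_of_odd)
    (hCassels : bsdRHS_eq_of_isIsogenous)
    (hres : ∀ (W : WeierstrassCurve ℚ) [W.IsElliptic] [W.IsGloballyMinimal] (p : ℕ) [Fact p.Prime],
      CellC W p → W.HasSplitMultiplicativeReductionAtPrime p → SplitHsiehFrameResidualAt W p)
    (h2 : ∀ (W : WeierstrassCurve ℚ) [W.IsElliptic] [W.IsGloballyMinimal] (p : ℕ) [Fact p.Prime],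
      CellC W p → W.HasSplitMultiplicativeReductionAtPrime p → SplitBDPValueOnTree W p)
    (h3 : ∀ (W : WeierstrassCurve ℚ) [W.IsElliptic] [W.IsGloballyMinimal] (p : ℕ) [Fact p.Prime],
      CellC W p → W.HasSplitMultiplicativeReductionAtPrime p → SplitIMCEqOnTree W p)
    (hCTL : ∀ (W : WeierstrassCurve ℚ) [W.IsElliptic] [W.IsGloballyMinimal] (p : ℕ) [Fact p.Prime],
      CellC W p → W.HasSplitMultiplicativeReductionAtPrime p → SplitControlOnTree W p)
    (hMCB : ∀ (W : WeierstrassCurve ℚ) [W.IsElliptic] [W.IsGloballyMinimal] (p : ℕ) [Fact p.Prime],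
      CellB W p → W.HasSplitMultiplicativeReductionAtPrime p → MazurMainConjectureAt W p)
    (W : WeierstrassCurve ℚ) [W.IsElliptic] [W.IsGloballyMinimal] (p : ℕ) [Fact p.Prime]
    (hc : CellC W p) (hs : W.HasSplitMultiplicativeReductionAtPrime p) : BSDp W p := by
  refine bsdp_of_cellC_of_forall_isIsogenous hEd hMaz hCassels hpar hnf hGZK W p hc ?_
  intro W₀ _ _ hiso hc₀ hMan₀
  have hs₀ : W₀.HasSplitMultiplicativeReductionAtPrime p :=
    IsogenyQuotientLine.hasSplitMultiplicativeReductionAtPrime_of_isIsogenous hiso hs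
  exact bsdp_of_cellC_of_split_of_manin_of_residuals W₀ p hGV hWu hJs hJn hHs hHn hpar hGS hnf hH hGZ
    hKo hHP hGZK hHL hc₀ hs₀ hMan₀ (hres W₀ p hc₀ hs₀) (h2 W₀ p hc₀ hs₀) (h3 W₀ p hc₀ hs₀)
    (hCTL W₀ p hc₀ hs₀) (fun W' _ _ hB hs' ↦ hMCB W' p hB hs')

end ClassLevel

end Summit.BirchSwinnertonDyer.Rank1Residual.X2

end
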